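import Summits.SmoothPoincare4.SmoothPoincare4.Theorems.CongruenceShadowsAgkCor6SufficiencyStubLevelDatumExists
import Literature.Topology.FourManifolds.SPC4Handles
import Literature.Topology.FourManifolds.SPC4HandlesTwoHandlebodyGenusCount
import Literature.Topology.FourManifolds.CorkDecomposition
import Literature.Topology.FourManifolds.RegularLevelSplitting
import Literature.Topology.FourManifolds.HandlesProofs
import Literature.Topology.FourManifolds.MorseTurnAbout
import HarnessLib

/-!
# Stub `stub_twoHandlebodyReassembly` (R2) of line `level-set-kirby-triple` for crux `AgkCor6Sufficiency`
(item stmt-SmoothPoincare4-10894; routes `CongruenceShadows` / `GroupTrisection`, crux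
`Summit.SmoothPoincare4.SmoothPoincare4.Theses.CongruenceShadows.AgkCor6Sufficiency`, Abrams–Gay–Kirby Cor. 6 ⇐;
checked skeleton `Cruxes/AgkCor6Sufficiency/Lines/level-set-kirby-triple.lean`)

**Reassembly along the smooth top level** (spc4.S24, second half — a closed smooth `4`-manifold is
determined by its `2`-handlebody: Matsumoto, *An Introduction to Morse Theory* (2001), §5.3,
Lemma 5.20; Kirby, *The topology of 4-manifolds* (1989), Ch. I §2, p. 8; Gompf–Stipsicz (1999),
§4.4 — from the Laudenbach–Poénaru extension theorem).  For level data `d`, `d'` of the same type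
`(g; κ)` on closed connected oriented smooth `4`-manifolds `M`, `M'` (the line's vocabulary
`LevelDatum`, `LevelDatum.TwoHandlebody := RegularSublevel d.regularTop`, imported from the module of
stub (E₀) `…Theorems.CongruenceShadowsAgkCor6SufficiencyStubLevelDatumExists`), a diffeomorphism of
the `2`-handlebodies `{f ≤ c} ≅ {f' ≤ c'}` yields `M ≅ M'`, GIVEN the tree's named fact
`Literature.Topology.FourManifolds.exists_diffeomorph_comp_incl_eq.{0}` (Laudenbach–Poénaru 1972,
registered as the separate stub `stub_laudenbachPoenaru`; taken here as the antecedent, not proved).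

Proof (pure glue over the tree, no new geometry):
* `M = {f ≤ c} ∪_{f⁻¹(c)} {f ≥ c}` is `RegularSublevel.isBoundaryGluing_split d.regularTop`
  (`RegularLevelSplitting.lean`; the second piece is `RegularSuperlevel`, the regular sublevel set
  `{c - f ≤ 0}` of the turned-about function);
* `W = {f ≤ c}` is `IsHandlebodyOfIndexLE 3 2` and `V = {f ≥ c}` is `IsHandlebodyOfIndexLE 3 1`, read
  off `RegularSublevel.morseData` (Milnor 1963, Thm. 3.1) and the datum's Morse bookkeeping
  (`morseIndex_le_two_of_lt_top`, `ncard_top_of_le_two`, with Milnor's index flip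
  `IsMorse.morseIndex_const_sub_add` for `c - f`); `V` is connected
  (`RegularSublevel.connectedSpace_superlevel`: the unique index-`4` point, `ncard_top_four`) and
  orientable (`RegularSublevel.isOrientable`);
* the gluing of `M'` is moved along the given `Θ : {f ≤ c} ≅ {f' ≤ c'}` by
  `IsBoundaryGluing.transfer` (`CorkDecomposition.lean`), so that `M` and `M'` are glued from the SAME
  `2`-handlebody, and spc4.S24 (c) in the form
  `nonempty_diffeomorph_of_isBoundaryGluing_twoHandlebody_of_exists_diffeomorph_comp_incl_eq hLP`
  (`SPC4HandlesTwoHandlebodyGenusCount.lean`) finishes.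

This file declares the registered statement `TwoHandlebodyReassembly` (verbatim from the skeleton) and
proves the registered stub `stub_twoHandlebodyReassembly : exists_diffeomorph_comp_incl_eq.{0} →
TwoHandlebodyReassembly`.  No `sorry`, no new named fact.
-/

noncomputable section

-- the prescribed namespace `Summit.<P>.<Sub>.…` duplicates `SmoothPoincare4` (P = Sub)
set_option linter.dupNamespace false

open Set Function
open scoped Manifold ContDiff ContinuousMap Topology

namespace Summit.SmoothPoincare4.SmoothPoincare4.Cruxes.AgkCor6Sufficiency.LevelSetKirbyTriple

open Literature.Topology.FourManifolds

/-! ## The statement of stub (R2) -/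

/-- **(R2) Reassembly along the smooth top level** (spc4.S24, second half: a closed `4`-manifold is
determined by its `2`-handlebody — Matsumoto 2001, Lemma 5.20; Kirby 1989, Ch. I §2, p. 8 — the
tree's `nonempty_diffeomorph_of_isBoundaryGluing_twoHandlebody`, proved from Laudenbach–Poénaru):
for level data of the same type, a diffeomorphism of the `2`-handlebodies `{f ≤ c}` yields a
diffeomorphism of the closed manifolds (`M = {f ≤ c} ∪_{f⁻¹(c)} {f ≥ c}`,
`RegularSublevel.isBoundaryGluing_split`, and `{f ≥ c} ≅ ♮^{κ 2} S¹ × B³`). -/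
def TwoHandlebodyReassembly : Prop :=
  ∀ (M : Type) [TopologicalSpace M] [T2Space M] [SecondCountableTopology M] [CompactSpace M]
    [ChartedSpace (EuclideanSpace ℝ (Fin 4)) M] [IsManifold (𝓡 4) ∞ M] [ConnectedSpace M]
    (_ : SmoothOrientation (𝓡 4) M)
    (M' : Type) [TopologicalSpace M'] [T2Space M'] [SecondCountableTopology M'] [CompactSpace M']
    [ChartedSpace (EuclideanSpace ℝ (Fin 4)) M'] [IsManifold (𝓡 4) ∞ M'] [ConnectedSpace M']
    (_ : SmoothOrientation (𝓡 4) M')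
    (g : ℕ) (κ : Fin 3 → ℕ) (d : LevelDatum M g κ) (d' : LevelDatum M' g κ),
    Nonempty (d.TwoHandlebody ≃ₘ⟮𝓡∂ 4, 𝓡∂ 4⟯ d'.TwoHandlebody) → Nonempty (M ≃ₘ⟮𝓡 4, 𝓡 4⟯ M')

/-! ## Stub (R2): reassembly along the smooth top level (spc4.S24 from Laudenbach–Poénaru) -/

namespace LevelDatum

variable {M : Type} [TopologicalSpace M] [T2Space M] [SecondCountableTopology M]
  [CompactSpace M] [ChartedSpace (EuclideanSpace ℝ (Fin 4)) M] [IsManifold (𝓡 4) ∞ M]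
  {g : ℕ} {κ : Fin 3 → ℕ}

/-- **Above the top level every critical point has index `≥ 3`**: the set of critical points
of index `i ≤ 2` above `c` has `ncard = 0` (`ncard_top_of_le_two`) and is finite (the critical
set of a Morse function on a compact manifold is finite, `IsMorse.finite_criticalSet_holds`;
Milnor, *Morse theory* (1963), Cor. 2.3), hence empty. -/
theorem three_le_morseIndex_of_top_lt (d : LevelDatum M g κ) {p : M}
    (hp : IsMCriticalPt (𝓡 4) d.B.f p) (hlt : d.T.c < d.B.f p) :
    3 ≤ morseIndex (𝓡 4) d.B.f p := by
  by_contra h3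
  have hle : morseIndex (𝓡 4) d.B.f p ≤ 2 := by omega
  have hfin : (criticalSetOfIndex (𝓡 4) d.B.f (morseIndex (𝓡 4) d.B.f p) ∩
      d.B.f ⁻¹' Set.Ioi d.T.c).Finite :=
    ((IsMorse.finite_criticalSet_holds d.T.Fr.isMorse).subset
      (criticalSetOfIndex_subset _ _ _)).subset Set.inter_subset_left
  have hempty := (Set.ncard_eq_zero hfin).1 (d.ncard_top_of_le_two _ hle)
  have hmem : p ∈ criticalSetOfIndex (𝓡 4) d.B.f (morseIndex (𝓡 4) d.B.f p) ∩
      d.B.f ⁻¹' Set.Ioi d.T.c := ⟨⟨hp, rfl⟩, hlt⟩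
  rw [hempty] at hmem
  exact hmem

/-- A critical point not strictly below the top level lies strictly above it (the top level
`c` itself carries no critical point, `T.regular_c`). -/
theorem top_lt_of_not_lt (d : LevelDatum M g κ) {p : M} (hp : IsMCriticalPt (𝓡 4) d.B.f p)
    (h : ¬ d.B.f p < d.T.c) : d.T.c < d.B.f p :=
  lt_of_le_of_ne (not_lt.1 h) fun heq => d.T.regular_c p heq.symm hp

/-- **The critical points of index `4` all lie above the top level** (below it indices are
`≤ 2`, `morseIndex_le_two_of_lt_top`; on it there is none). -/
theorem criticalSetOfIndex_four_eq (d : LevelDatum M g κ) :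
    criticalSetOfIndex (𝓡 4) d.B.f 4 =
      criticalSetOfIndex (𝓡 4) d.B.f 4 ∩ d.B.f ⁻¹' Set.Ioi d.T.c := by
  refine (Set.inter_eq_left.2 fun p hp => ?_).symm
  obtain ⟨hpc, hp4⟩ := mem_criticalSetOfIndex.1 hp
  show d.T.c < d.B.f p
  refine d.top_lt_of_not_lt hpc fun hlt => ?_
  have := d.morseIndex_le_two_of_lt_top p hpc hlt
  omega

/-- **The `2`-handlebody `{f ≤ c}` has handles of index `≤ 2` only** (`IsHandlebodyOfIndexLE 3 2`):
its adapted Morse function `f|{f ≤ c} + (1 - c)` (`RegularSublevel.morseData`; Milnor 1963,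
Thm. 3.1 and §3) has the critical points of `f` below `c`, with the same indices, and these are
`≤ 2` (`morseIndex_le_two_of_lt_top`). -/
theorem isHandlebodyOfIndexLE_twoHandlebody (d : LevelDatum M g κ) :
    IsHandlebodyOfIndexLE 3 2 d.TwoHandlebody := by
  obtain ⟨h1, h2, h3⟩ := RegularSublevel.morseData d.T.Fr.isMorse d.regularTop
  refine ⟨_, h1, fun z hz => ?_⟩
  have hz' := (h2 z).1 hz
  rw [h3 z hz']
  refine d.morseIndex_le_two_of_lt_top _ hz'
    (lt_of_le_of_ne (RegularSublevel.apply_incl_le d.regularTop z) fun heq => ?_)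
  exact d.T.regular_c _ heq hz'

/-- **The superlevel set `V = {f ≥ c}` is a `1`-handlebody** (`IsHandlebodyOfIndexLE 3 1`): it is
the regular sublevel set `{c - f ≤ 0}` of the turned-about Morse function `c - f`
(`RegularSuperlevel`, `IsMorse.const_sub`), whose adapted Morse function has the critical points
of `f` above `c` with the complementary indices `4 - i` (Milnor, *Lectures on the h-cobordism
theorem* (1965), proof of Thm. 9.1: `IsMorse.morseIndex_const_sub_add`), and above `c` the indices
of `f` are `≥ 3` (`three_le_morseIndex_of_top_lt`). -/
theorem isHandlebodyOfIndexLE_superlevel (d : LevelDatum M g κ) :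
    IsHandlebodyOfIndexLE 3 1 (RegularSuperlevel d.regularTop) := by
  obtain ⟨h1, h2, h3⟩ :=
    RegularSublevel.morseData (d.T.Fr.isMorse.const_sub d.T.c) d.regularTop.const_sub
  refine ⟨_, h1, fun z hz => ?_⟩
  have hz' := (h2 z).1 hz
  rw [h3 z hz']
  have hd : MDifferentiableAt (𝓡 4) 𝓘(ℝ, ℝ) d.B.f
      (RegularSublevel.incl d.regularTop.const_sub z) :=
    d.T.Fr.isMorse.contMDiff.mdifferentiableAt (by simp)
  have hzf : IsMCriticalPt (𝓡 4) d.B.f (RegularSublevel.incl d.regularTop.const_sub z) :=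
    (isMCriticalPt_const_sub_iff d.T.c hd).1 hz'
  have hsum := d.T.Fr.isMorse.morseIndex_const_sub_add d.T.c hzf
  rw [finrank_euclideanSpace_fin] at hsum
  have hge : d.T.c ≤ d.B.f (RegularSublevel.incl d.regularTop.const_sub z) :=
    sub_nonpos.1 (RegularSublevel.apply_incl_le d.regularTop.const_sub z)
  have hlt : d.T.c < d.B.f (RegularSublevel.incl d.regularTop.const_sub z) :=
    lt_of_le_of_ne hge fun heq => d.T.regular_c _ heq.symm hzf
  have h3le := d.three_le_morseIndex_of_top_lt hzf hlt
  change morseIndex (𝓡 4) (fun y => d.T.c - d.B.f y)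
    (RegularSublevel.incl d.regularTop.const_sub z) ≤ 1
  omega

/-- **The superlevel set `V = {f ≥ c}` is connected**: `f` has exactly one critical point of
index `4` (it lies above `c`, `ncard_top_four`, and no index-`4` point lies below or on `c`), so
Reeb's argument applies to `c - f` (`RegularSublevel.connectedSpace_superlevel`; Milnor 1963,
proof of Thm. 4.1), and `{f ≥ c}` contains that maximum. -/
theorem connectedSpace_superlevel (d : LevelDatum M g κ) :
    ConnectedSpace (RegularSuperlevel d.regularTop) := by
  obtain ⟨x, hx⟩ := Set.ncard_eq_one.1 d.ncard_top_four
  have hxmem : x ∈ criticalSetOfIndex (𝓡 4) d.B.f 4 ∩ d.B.f ⁻¹' Set.Ioi d.T.c := by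
    rw [hx]; exact Set.mem_singleton x
  refine RegularSublevel.connectedSpace_superlevel d.T.Fr.isMorse d.regularTop ?_
    ⟨x, le_of_lt hxmem.2⟩
  show (criticalSetOfIndex (𝓡 4) d.B.f 4).Subsingleton
  rw [d.criticalSetOfIndex_four_eq, hx]
  exact Set.subsingleton_singleton

/-- **The superlevel set `V = {f ≥ c}` of an oriented `M` is orientable** (a codimension-`0`
submanifold with boundary of an oriented manifold, `RegularSublevel.isOrientable`; Hirsch,
*Differential Topology* (1976), §4.4). -/
theorem isOrientable_superlevel (d : LevelDatum M g κ) (o : SmoothOrientation (𝓡 4) M) :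
    IsOrientable (𝓡∂ 4) (RegularSuperlevel d.regularTop) :=
  RegularSublevel.isOrientable d.regularTop.const_sub ⟨o⟩

/-- **`M = {f ≤ c} ∪_{f⁻¹(c)} {f ≥ c}`**: the closed manifold is the boundary gluing of the
`2`-handlebody and the superlevel set along the level (`RegularSublevel.isBoundaryGluing_split`;
Milnor 1963, Thm. 3.1 and §3). -/
theorem isBoundaryGluing_twoHandlebody (d : LevelDatum M g κ) :
    IsBoundaryGluing (RegularSublevel.boundaryData d.regularTop)
      (RegularSublevel.boundaryData d.regularTop.const_sub)
      (RegularSublevel.splitDiffeomorph d.regularTop) (𝓡 4) M :=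
  RegularSublevel.isBoundaryGluing_split d.regularTop

end LevelDatum

/-- **spc4.S24 with the second gluing transported** (Matsumoto 2001, Lemma 5.20; Kirby 1989,
Ch. I §2, p. 8, from Laudenbach–Poénaru): if `M = W ∪_φ V` and `M' = W' ∪_{φ'} V'` are closed
smooth `4`-manifolds glued from compact `2`-handlebodies `W ≅ W'` (a diffeomorphism `Θ`) and
compact connected orientable `1`-handlebodies `V`, `V'`, then `M ≅ M'`.  The gluing of `M'` is
moved along `Θ` (`IsBoundaryGluing.transfer`: `M' = W ∪_{φ' ∘ ∂Θ} V'`), after which both are glued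
from the same `W` and the tree's
`nonempty_diffeomorph_of_isBoundaryGluing_twoHandlebody_of_exists_diffeomorph_comp_incl_eq`
(the named fact spc4.S24 (c) from the Laudenbach–Poénaru extension fact `hLP`) applies. -/
theorem nonempty_diffeomorph_of_isBoundaryGluing_of_diffeomorph
    (hLP : exists_diffeomorph_comp_incl_eq.{0})
    (M M' : Type) [TopologicalSpace M] [T2Space M] [SecondCountableTopology M] [CompactSpace M]
    [ChartedSpace (EuclideanSpace ℝ (Fin 4)) M] [IsManifold (𝓡 4) ∞ M]
    [TopologicalSpace M'] [T2Space M'] [SecondCountableTopology M'] [CompactSpace M']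
    [ChartedSpace (EuclideanSpace ℝ (Fin 4)) M'] [IsManifold (𝓡 4) ∞ M']
    (W W' V V' : Type) [TopologicalSpace W] [T2Space W] [SecondCountableTopology W]
    [CompactSpace W] [ChartedSpace (EuclideanHalfSpace 4) W] [IsManifold (𝓡∂ 4) ∞ W]
    [TopologicalSpace W'] [ChartedSpace (EuclideanHalfSpace 4) W'] [IsManifold (𝓡∂ 4) ∞ W']
    [TopologicalSpace V] [T2Space V] [SecondCountableTopology V] [CompactSpace V]
    [ConnectedSpace V] [ChartedSpace (EuclideanHalfSpace 4) V] [IsManifold (𝓡∂ 4) ∞ V]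
    [TopologicalSpace V'] [T2Space V'] [SecondCountableTopology V'] [CompactSpace V']
    [ConnectedSpace V'] [ChartedSpace (EuclideanHalfSpace 4) V'] [IsManifold (𝓡∂ 4) ∞ V']
    (hW : IsHandlebodyOfIndexLE 3 2 W) (hV : IsHandlebodyOfIndexLE 3 1 V)
    (hV' : IsHandlebodyOfIndexLE 3 1 V') (hoV : IsOrientable (𝓡∂ 4) V)
    (hoV' : IsOrientable (𝓡∂ 4) V')
    (bW : BoundaryData (𝓡∂ 4) W (𝓡 3)) (bW' : BoundaryData (𝓡∂ 4) W' (𝓡 3))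
    (bV : BoundaryData (𝓡∂ 4) V (𝓡 3)) (bV' : BoundaryData (𝓡∂ 4) V' (𝓡 3))
    (φ : bW.carrier ≃ₘ⟮𝓡 3, 𝓡 3⟯ bV.carrier) (φ' : bW'.carrier ≃ₘ⟮𝓡 3, 𝓡 3⟯ bV'.carrier)
    (hM : IsBoundaryGluing bW bV φ (𝓡 4) M) (hM' : IsBoundaryGluing bW' bV' φ' (𝓡 4) M')
    (Θ : W ≃ₘ⟮𝓡∂ 4, 𝓡∂ 4⟯ W') : Nonempty (M ≃ₘ⟮𝓡 4, 𝓡 4⟯ M') := by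
  have hM'' : IsBoundaryGluing bW bV' ((bW.restrictDiffeomorph bW' Θ).trans φ') (𝓡 4) M' := by
    rw [Diffeomorph.coe_trans]
    exact hM'.transfer Θ
  exact nonempty_diffeomorph_of_isBoundaryGluing_twoHandlebody_of_exists_diffeomorph_comp_incl_eq
    hLP M M' W V V' hW hV hV' hoV hoV' bW bV bV' φ _ hM hM''

/-- **(R2) Reassembly along the smooth top level, from Laudenbach–Poénaru** (spc4.S24, second
half; Matsumoto 2001, Lemma 5.20; Kirby 1989, Ch. I §2, p. 8; Gompf–Stipsicz 1999, §4.4).  For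
level data `d`, `d'` of the same type on closed connected oriented smooth `4`-manifolds `M`, `M'`,
a diffeomorphism `Θ : {f ≤ c} ≅ {f' ≤ c'}` of the `2`-handlebodies yields `M ≅ M'`: split
`M = {f ≤ c} ∪_{f⁻¹(c)} {f ≥ c}` and `M'` likewise along the smooth top levels
(`RegularSublevel.isBoundaryGluing_split`); the superlevel sets are compact connected orientable
`1`-handlebodies (the turned-about function `c - f` has there the critical points of `f` above
`c`, of indices `4 - i ≤ 1`, exactly one of them of index `0`); move the gluing of `M'` along `Θ`
and apply spc4.S24 (c) in the form
`nonempty_diffeomorph_of_isBoundaryGluing_twoHandlebody_of_exists_diffeomorph_comp_incl_eq hLP`. -/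
theorem stub_twoHandlebodyReassembly :
    exists_diffeomorph_comp_incl_eq.{0} → TwoHandlebodyReassembly := by
  intro hLP M _ _ _ _ _ _ _ o M' _ _ _ _ _ _ _ o' g κ d d' hΘ
  obtain ⟨Θ⟩ := hΘ
  haveI := d.connectedSpace_superlevel
  haveI := d'.connectedSpace_superlevel
  exact nonempty_diffeomorph_of_isBoundaryGluing_of_diffeomorph hLP M M' d.TwoHandlebody
    d'.TwoHandlebody (RegularSuperlevel d.regularTop) (RegularSuperlevel d'.regularTop)
    d.isHandlebodyOfIndexLE_twoHandlebody d.isHandlebodyOfIndexLE_superlevel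
    d'.isHandlebodyOfIndexLE_superlevel (d.isOrientable_superlevel o)
    (d'.isOrientable_superlevel o') (RegularSublevel.boundaryData d.regularTop)
    (RegularSublevel.boundaryData d'.regularTop)
    (RegularSublevel.boundaryData d.regularTop.const_sub)
    (RegularSublevel.boundaryData d'.regularTop.const_sub)
    (RegularSublevel.splitDiffeomorph d.regularTop) (RegularSublevel.splitDiffeomorph d'.regularTop)
    d.isBoundaryGluing_twoHandlebody d'.isBoundaryGluing_twoHandlebody Θ

end Summit.SmoothPoincare4.SmoothPoincare4.Cruxes.AgkCor6Sufficiency.LevelSetKirbyTriple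

end
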